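import Summits.BirchSwinnertonDyer.BirchSwinnertonDyer.Theorems.GoldfeldAllTwistsTwoConverseTwinBirchTorsionK
import Summits.BirchSwinnertonDyer.BirchSwinnertonDyer.Theorems.GoldfeldAllTwistsTwoConverseTwinHeegnerHalvesExactOrder
import HarnessLib

set_option linter.dupNamespace false -- `…BirchSwinnertonDyer.BirchSwinnertonDyer…` is the cell's namespace (D-0017)
set_option autoImplicit false

/-!
# Twin″ (item 19140) — line «heegner-halves» v2: **`t_K = #W(K)_tors = 2` ON THE WHOLE `j = −3375` CELL, FOR
# EVERY HEEGNER FIELD `K`**, and the exact value of `ord₂ 𝔮` with `t_K` folded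

Leafhand `leafhand-bsd-goldfeldalltwistst-5-g0` (prover, explicit unit, 2026-08-31), `--supports
stmt-BirchSwinnertonDyer-19140` (crux twin″ `BSDTwoCMSevenAdditiveRankOne`, registered skeleton `5ff791a1e67d6e63` =
line «heegner-halves» v2). Theses-free; theorems only; no `sorry`, no definition, no new named fact, no notation, no
local or scoped instances. HONEST FRAMING: a torsion computation over an infinite family of quadratic fields plus bookkeeping GRANTED the
halves' five published binders; it closes NO stub of the line (the two `2`-adic halves stay research-open); item 19140 is
NOT closed; BSD is proved for no curve.

WHAT. The previous hand's exact formula (`padicValRat_cmHeegnerIndexQuotient_cell_eq`, file `…ExactOrder`) left ONE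
arithmetic invariant of the Heegner datum unevaluated besides the index `I`, the halvability value `k` and the Manin
constant `c`: the torsion order `t_K = #W(K)_tors` of the cell curve over the Heegner field. This file evaluates it:
* §1 (generic, any number field `K`) `torsionOrder_eq_two_of_twoTorsionNF`: a curve `y² = x³ + ax² + bx` over `K` with
  `a² − 4b ∉ K²`, `b ∉ K²` and no point killed by an odd integer except `O` has `#E(K)_tors = 2` (the tree's
  `exists_odd_nsmul_mem_pair` / `eq_zero_or_eq_twoTorsionPoint_of_two_nsmul_eq_zero`; the argument of
  `…TwinBirchTorsionK` §4 freed from the literal model).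
* §2 (generic, `K` imaginary quadratic, `V/ℚ` any equation) `eq_zero_of_odd_nsmul_eq_zero_quadraticTwist_one_baseChange`:
  if `#V^{(1)}(ℚ)_tors = #V^{(d_K)}(ℚ)_tors = 2`, no point of `V^{(1)}(K)` but `O` is killed by an odd integer (with `σ`
  the conjugation, `P + σP` comes from `V^{(1)}(ℚ)`, so it is `O`; then `σP = −P` and `P` comes from the twist
  `V^{(d_K)}(ℚ)`: Silverman X.2 Prop. 2.4 / Exercise 10.16, the argument of `…TwinBirchTorsionK` §3 freed from the model).
* §3 (the cell) `torsionOrder_baseChange_eq_two_of_smul_eq_cm7_quadraticTwist`: for EVERY model `W` of `X₀(49)^{(d)}`,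
  `d ≠ 0`, and EVERY imaginary quadratic `K` in which `−7` is not a square — equivalently `K ≠ ℚ(√−7)`; in particular
  every Heegner field of the cell, where `7` splits (`not_isSquare_neg_seven_of_jacobiSym_eq_one`) —
  **`#W(K)_tors = 2`**: the two-torsion normal form `⟨0, 21d, 0, 112d², 0⟩` has `a² − 4b = −7d²`, `b = 7·(4d)²`, and `7`
  is a square in no imaginary quadratic field (`not_isSquare_seven_of_isImaginaryQuadratic`); the odd part descends to
  `#X₀(49)^{(d)}(ℚ)_tors = #X₀(49)^{(d·d_K)}(ℚ)_tors = 2` (`j = −3375`, Olson).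
* §4 `padicValRat_cmHeegnerIndexQuotient_cell_eq_of_torsionK`: hence on the `j = −3375` cell, for every admissible Heegner
  datum, **`ord₂ 𝔮 = 2·ord₂ I − 2·ord₂ k − 2·ord₂ c + 3 − ord₂ #Ш(Wd) − (3 + ι(d·D) + 2σ′(d·D)) − (3 + ι(d) + 2σ′(d))`** —
  the two registered half-stubs read, on this cell and modulo the print stub,
  `ord₂ #Ш(W) ≤ / ≥ 2·ord₂ I − 2·ord₂ k − 2·ord₂ c − 3 − ord₂ #Ш(Wd) − (ι(d) + ι(d·D)) − 2(σ′(d) + σ′(d·D))`,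
  with `I = [W(K) : ℤP]`, `k ∈ {1, 2}` the halvability value, `c` the Manin constant of the datum: no torsion order, unit
  count, period, `L`-value or Tamagawa number left.
* §5 (appended) `exists_incl_eq_of_isOfFinAddOrder_of_smul_eq_cm7_quadraticTwist` / `…_of_cellTwist`: `W(K)_tors = W(ℚ)_tors`
  — every `K`-torsion point of a cell curve is `ℚ`-rational (counting: `incl` is injective on torsion and both orders are
  `2`), so the halvability clause `incl y − 2 • Q ∈ W(K)_tors` of the half-stubs may be read inside `W(ℚ)_tors = {O, T}`.

References: [SilvermanAEC2009] VII.3, VIII.7, X.2 Prop. 2.4, Exercise 10.16; [SilvermanTate2015] §3.5; [Olson1974] Thm. 1;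
[BurungaleCastellaSkinnerTian2022] Rem. D (p. 327); [GrossZagier1986] I.6.3, V.§2; [BurungaleFlach2024] Thm. 1.1, Cor. 2.
-/

noncomputable section

open scoped Classical

open WeierstrassCurve NumberField Literature.NumberTheory.EllipticCurves Literature.NumberTheory.QuadraticFields
  Literature.NumberTheory.EllipticCurves.ModularForms Literature.NumberTheory.EllipticCurves.Rank1Residual
  Literature.NumberTheory.EllipticCurves.Rank1Residual.Typed WeierstrassCurve.QuadraticDescent

namespace Summit.BirchSwinnertonDyer.BirchSwinnertonDyer.Theorems.GoldfeldGoodTwists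

open Summit.BirchSwinnertonDyer.Rank1Residual Summit.BirchSwinnertonDyer.Rank1Residual.P2

-- Decidability: every statement about `ℚ`-points below is phrased through the invariant `torsionOrder` (whose body fixes
-- the classical world of `MordellWeil.lean`); inside the one proof that manipulates `ℚ`-points (§2) the classical
-- `DecidableEq ℚ` is bound with `letI`, matching the tree's `incl` / `twistMap` / `…TwinBirchTorsionK`.

/-! ## §1 Two-torsion normal forms over a number field: `#E(K)_tors = 2` -/

section TwoTorsionNF

variable {K : Type} [Field K]

/-- **`E(K)_tors = {O, T}`** for `E : y² = x³ + ax² + bx` over `K` with `a² − 4b`, `b ∉ K²` and no point but `O` killed by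
an odd integer: a torsion point `t` has an odd multiple in `{O, T}` (`exists_odd_nsmul_mem_pair`), so `2 • t` is killed
by an odd integer, hence `O`, and `t ∈ E(K)[2] = {O, T}`. [cite: SilvermanTate2015, §3.5] [cite: SilvermanAEC2009, Exercise 10.16] -/
theorem isOfFinAddOrder_iff_of_twoTorsionNF (V : WeierstrassCurve K) [V.IsTwoTorsionNF] [V.IsElliptic]
    (hD : ¬ IsSquare (V.a₂ ^ 2 - 4 * V.a₄)) (hb : ¬ IsSquare V.a₄)
    (hodd : ∀ (P : V.toAffine.Point) (m : ℕ), Odd m → m • P = 0 → P = 0)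
    (t : V.toAffine.Point) : IsOfFinAddOrder t ↔ t = 0 ∨ t = V.twoTorsionPoint := by
  constructor
  · intro ht
    obtain ⟨m, hm, h⟩ := V.exists_odd_nsmul_mem_pair hD hb ht
    have h2m : m • ((2 : ℕ) • t) = 0 := by
      rw [← mul_nsmul', mul_comm, mul_nsmul']
      rcases h with h | h
      · rw [h, nsmul_zero]
      · rw [h, two_nsmul, twoTorsionPoint_add_twoTorsionPoint]
    have h2 : (2 : ℕ) • t = 0 := hodd _ m hm h2m
    exact V.eq_zero_or_eq_twoTorsionPoint_of_two_nsmul_eq_zero hD t h2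
  · rintro (rfl | rfl)
    · exact IsOfFinAddOrder.zero
    · exact isOfFinAddOrder_iff_nsmul_eq_zero.mpr
        ⟨2, two_pos, by rw [two_nsmul, twoTorsionPoint_add_twoTorsionPoint]⟩

/-- **`#E(K)_tors = 2`** for `E : y² = x³ + ax² + bx` over a field `K` with `a² − 4b ∉ K²`, `b ∉ K²` and no point
but `O` killed by an odd integer. [cite: SilvermanTate2015, §3.5] [cite: SilvermanAEC2009, VII.3 and Exercise 10.16] -/
theorem torsionOrder_eq_two_of_twoTorsionNF (V : WeierstrassCurve K) [V.IsTwoTorsionNF] [V.IsElliptic]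
    (hD : ¬ IsSquare (V.a₂ ^ 2 - 4 * V.a₄)) (hb : ¬ IsSquare V.a₄)
    (hodd : ∀ (P : V.toAffine.Point) (m : ℕ), Odd m → m • P = 0 → P = 0) : V.torsionOrder = 2 := by
  unfold WeierstrassCurve.torsionOrder
  set T := V.twoTorsionPoint with hT
  have hTtors : T ∈ AddCommGroup.torsion V.toAffine.Point :=
    (AddCommGroup.mem_torsion _).mpr ((isOfFinAddOrder_iff_of_twoTorsionNF V hD hb hodd T).mpr (Or.inr rfl))
  have hT0 : T ≠ 0 := twoTorsionPoint_ne_zero _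
  rw [Nat.card_eq_two_iff' (⟨T, hTtors⟩ : AddCommGroup.torsion V.toAffine.Point)]
  refine ⟨0, fun h0 => hT0 (congrArg Subtype.val h0).symm, fun y hy => ?_⟩
  have hyfin : IsOfFinAddOrder (y : V.toAffine.Point) := y.2
  rcases (isOfFinAddOrder_iff_of_twoTorsionNF V hD hb hodd _).mp hyfin with h | h
  · exact Subtype.ext h
  · exact absurd (Subtype.ext h) hy

end TwoTorsionNF

/-! ## §2 Odd torsion over an imaginary quadratic field descends to `ℚ` and to the twist -/

section OddDescent

variable {K : Type} [Field K] [NumberField K]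

/-- **Odd torsion of `V(K)` is trivial when `#V^{(1)}(ℚ)_tors = #V^{(d_K)}(ℚ)_tors = 2`** (on the completed-square
copy `V^{(1)} ⊗ K`, the model of the tree's `QuadraticDescent`): for `K` imaginary quadratic and `P ∈ V^{(1)}(K)` with
`n • P = O`, `n` odd: `P + σP ∈ V^{(1)}(ℚ)` is killed by `n`, hence `O` (`#tors = 2`); so `σP = −P`, `P = τ(R)` for
`R ∈ V^{(d_K)}(ℚ)` killed by `n`, hence `R = O`. [cite: SilvermanAEC2009, X.2 Prop. 2.4 and Exercise 10.16] -/
theorem eq_zero_of_odd_nsmul_eq_zero_quadraticTwist_one_baseChange (hK : IsImaginaryQuadratic K)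
    (V : WeierstrassCurve ℚ) (h1 : (V.quadraticTwist 1).torsionOrder = 2)
    (hd : (V.quadraticTwist (NumberField.discr K : ℚ)).torsionOrder = 2)
    (P : ((V.quadraticTwist 1).baseChange K).toAffine.Point) {n : ℕ} (hn : Odd n) (hP : n • P = 0) : P = 0 := by
  -- the `ℚ`-point groups of the tree's `incl` / `twistMap` / `torsionOrder` live in the classical decidability world
  letI : DecidableEq ℚ := fun a b => Classical.propDecidable (a = b)
  obtain ⟨δ, hδ, hδK, -⟩ := exists_sq_eq_discr_and_span hK
  have hθ : δ ∉ Set.range (algebraMap ℚ K) := by rintro ⟨a, ha⟩; exact hδK a ha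
  have hσσ : ∀ z, Quadratic.conj hK.1 hθ hδ (Quadratic.conj hK.1 hθ hδ z) = z := Quadratic.conj_conj hK.1 hθ hδ
  -- the `σ`-fixed part comes from `V^{(1)}(ℚ)` and is killed by `n`
  obtain ⟨Q, hQ⟩ : ∃ Q : (V.quadraticTwist 1).toAffine.Point,
      incl K (V.quadraticTwist 1) Q = P + conjMap (V.quadraticTwist 1) (Quadratic.conj hK.1 hθ hδ) P :=
    exists_incl_eq_of_conjMap_eq _ hK.1 hθ hδ (by rw [map_add, conjMap_conjMap _ hσσ, add_comm])
  have hQ0 : Q = 0 :=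
    eq_zero_of_odd_nsmul_eq_zero_of_torsionOrder_eq_two h1 hn
      (incl_injective (K := K) (V.quadraticTwist 1)
        (by rw [map_nsmul, hQ, map_zero, smul_add, ← map_nsmul, hP, map_zero, add_zero]))
  have hanti : conjMap (V.quadraticTwist 1) (Quadratic.conj hK.1 hθ hδ) P = -P := by
    have h : P + conjMap (V.quadraticTwist 1) (Quadratic.conj hK.1 hθ hδ) P = 0 := by
      rw [← hQ, hQ0, map_zero]
    exact (neg_eq_of_add_eq_zero_right h).symm
  -- the `σ`-anti-fixed point comes from the twist by `d_K`
  obtain ⟨R, hR⟩ : ∃ R : (V.quadraticTwist (NumberField.discr K : ℚ)).toAffine.Point, twistMap V hθ hδ R = P :=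
    exists_twistMap_eq_of_conjMap_eq_neg _ hK.1 hθ hδ hanti
  have hR0 : R = 0 :=
    eq_zero_of_odd_nsmul_eq_zero_of_torsionOrder_eq_two hd hn
      (twistMap_injective V hθ hδ (by rw [map_nsmul, hR, hP, map_zero]))
  rw [← hR, hR0, map_zero]

end OddDescent

/-! ## §3 The `j = −3375` cell over an imaginary quadratic field -/

section Cell

variable {K : Type} [Field K] [NumberField K]

/-- **`7` is a square in no imaginary quadratic field**: a rational square in `K` is a square in `ℚ` or `d_K` times one,
and `7` is not a rational square while `7·d_K < 0`. [folklore] -/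
theorem not_isSquare_seven_of_isImaginaryQuadratic (hK : IsImaginaryQuadratic K) : ¬ IsSquare (7 : K) := by
  intro h
  have h' : IsSquare (algebraMap ℚ K 7) := by rwa [map_ofNat]
  rcases isSquare_or_of_isSquare_algebraMap_rat hK h' with h7 | h7
  · rw [show (7 : ℚ) = ((7 : ℕ) : ℚ) by norm_num, Rat.isSquare_natCast_iff] at h7
    exact not_isSquare_prime (by norm_num) h7
  · have hD : ((NumberField.discr K : ℤ) : ℚ) < 0 := by exact_mod_cast hK.discr_neg
    exact not_isSquare_of_neg (by nlinarith) h7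

/-- **`−7` is not a square in an imaginary quadratic field in which `7` splits** (`(d_K/7) = 1`, e.g. a Heegner field
for a level divisible by `7`): `−7 < 0` is not a rational square, and `−7·d_K = m²` would force `7 ∣ d_K`, i.e.
`(d_K/7) = 0`. [folklore] -/
theorem not_isSquare_neg_seven_of_jacobiSym_eq_one (hK : IsImaginaryQuadratic K)
    (h7 : jacobiSym (NumberField.discr K) 7 = 1) : ¬ IsSquare (-7 : K) := by
  intro h
  have h' : IsSquare (algebraMap ℚ K (-7)) := by rwa [map_neg, map_ofNat]
  rcases isSquare_or_of_isSquare_algebraMap_rat hK h' with h7' | h7'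
  · exact not_isSquare_of_neg (by norm_num) h7'
  · rw [show (-7 : ℚ) * (NumberField.discr K : ℚ) = ((-7 * NumberField.discr K : ℤ) : ℚ) by push_cast; ring,
      Rat.isSquare_intCast_iff] at h7'
    obtain ⟨m, hm⟩ := h7'
    have h7m : (7 : ℤ) ∣ m := by
      have : (7 : ℤ) ∣ m * m := ⟨-NumberField.discr K, by linear_combination -hm⟩
      exact ((Int.prime_iff_natAbs_prime.mpr (by norm_num)).dvd_mul.mp this).elim id id
    obtain ⟨r, rfl⟩ := h7m
    have hdvd : ((7 : ℕ) : ℤ) ∣ NumberField.discr K :=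
      ⟨-(r * r), mul_left_cancel₀ (by norm_num : ((7 : ℕ) : ℤ) ≠ 0) (by push_cast; linear_combination -hm)⟩
    rw [jacobiSym.mod_left, Int.emod_eq_zero_of_dvd hdvd, jacobiSym.zero_left (by norm_num)] at h7
    exact zero_ne_one h7

/-- The two-torsion normal form `⟨0, 21d, 0, 112d², 0⟩` over `K` has `Δ = −2¹²·7³·d⁶ ≠ 0` for `d ≠ 0`: it is elliptic.
[cite: SilvermanAEC2009, III.1] -/
theorem isElliptic_twoTorsionNF_cell {d : ℤ} (hd : d ≠ 0) :
    (⟨0, 21 * (d : K), 0, 112 * (d : K) ^ 2, 0⟩ : WeierstrassCurve K).IsElliptic := by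
  refine ⟨isUnit_iff_ne_zero.mpr ?_⟩
  have hdK : (d : K) ≠ 0 := by exact_mod_cast hd
  rw [show (⟨0, 21 * (d : K), 0, 112 * (d : K) ^ 2, 0⟩ : WeierstrassCurve K).Δ = -1404928 * (d : K) ^ 6 by
    simp only [WeierstrassCurve.Δ, WeierstrassCurve.b₂, WeierstrassCurve.b₄, WeierstrassCurve.b₆,
      WeierstrassCurve.b₈]; ring]
  exact mul_ne_zero (by norm_num) (pow_ne_zero _ hdK)

/-- The completed-square copy of `X₀(49)`'s two-torsion normal form twisted by `d`, base-changed to `K`, is the literal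
equation `⟨0, 21d, 0, 112d², 0⟩` over `K`. [folklore] -/
theorem M0_quadraticTwist_quadraticTwist_one_baseChange (d : ℤ) :
    ((((⟨0, 21, 0, 112, 0⟩ : WeierstrassCurve ℚ).quadraticTwist (d : ℚ)).quadraticTwist 1).baseChange K) =
      (⟨0, 21 * (d : K), 0, 112 * (d : K) ^ 2, 0⟩ : WeierstrassCurve K) := by
  ext <;> simp [baseChange, WeierstrassCurve.map, quadraticTwist, WeierstrassCurve.b₂, WeierstrassCurve.b₄,
    WeierstrassCurve.b₆, eq_ratCast] <;> ring

/-- **`#E(K)_tors = 2` for the two-torsion normal form `E = ⟨0, 21d, 0, 112d², 0⟩` of `X₀(49)^{(d)}`** (`d ≠ 0`) over an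
imaginary quadratic `K` with `−7 ∉ K²`: `a² − 4b = −7d²` and `b = 7·(4d)²` are not squares in `K` (§3), and odd torsion
descends (§2) to `#X₀(49)^{(d)}(ℚ)_tors = #X₀(49)^{(d·d_K)}(ℚ)_tors = 2` (`torsionOrder_M0_quadraticTwist`, `j = −3375`).
[cite: SilvermanTate2015, §3.5] [cite: Olson1974, Thm. 1 (j = −3375)] [cite: SilvermanAEC2009, Exercise 10.16] -/
theorem torsionOrder_twoTorsionNF_cell_eq_two {d : ℤ} (hd : d ≠ 0) (hK : IsImaginaryQuadratic K)
    (h7 : ¬ IsSquare (-7 : K)) :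
    (⟨0, 21 * (d : K), 0, 112 * (d : K) ^ 2, 0⟩ : WeierstrassCurve K).torsionOrder = 2 := by
  haveI := isElliptic_twoTorsionNF_cell (K := K) hd
  have hdK : (d : K) ≠ 0 := by exact_mod_cast hd
  have hdQ : (d : ℚ) ≠ 0 := by exact_mod_cast hd
  have hDQ : (NumberField.discr K : ℚ) ≠ 0 := by exact_mod_cast NumberField.discr_ne_zero K
  refine torsionOrder_eq_two_of_twoTorsionNF _ ?_ ?_ ?_
  · rw [show (⟨0, 21 * (d : K), 0, 112 * (d : K) ^ 2, 0⟩ : WeierstrassCurve K).a₂ ^ 2 -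
        4 * (⟨0, 21 * (d : K), 0, 112 * (d : K) ^ 2, 0⟩ : WeierstrassCurve K).a₄ = -7 * (d : K) ^ 2 by ring]
    rintro ⟨r, hr⟩
    refine h7 ⟨r / d, ?_⟩
    rw [div_mul_div_comm, ← hr, pow_two, mul_div_assoc, div_self (mul_ne_zero hdK hdK), mul_one]
  · rw [show (⟨0, 21 * (d : K), 0, 112 * (d : K) ^ 2, 0⟩ : WeierstrassCurve K).a₄ = 112 * (d : K) ^ 2 from rfl]
    rintro ⟨r, hr⟩
    refine not_isSquare_seven_of_isImaginaryQuadratic hK ⟨r / (4 * d), ?_⟩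
    have h4 : (4 : K) ≠ 0 := by norm_num
    have h16 : (4 * (d : K)) * (4 * d) ≠ 0 := mul_ne_zero (mul_ne_zero h4 hdK) (mul_ne_zero h4 hdK)
    rw [div_mul_div_comm, ← hr, eq_div_iff h16]
    ring
  · intro P m hm hP
    set e := Affine.Point.congrEquiv (M0_quadraticTwist_quadraticTwist_one_baseChange (K := K) d) with he
    have h1 : (((⟨0, 21, 0, 112, 0⟩ : WeierstrassCurve ℚ).quadraticTwist (d : ℚ)).quadraticTwist 1).torsionOrder = 2 := by
      rw [quadraticTwist_quadraticTwist, mul_one]; exact torsionOrder_M0_quadraticTwist hdQ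
    have h2 : (((⟨0, 21, 0, 112, 0⟩ : WeierstrassCurve ℚ).quadraticTwist (d : ℚ)).quadraticTwist
        (NumberField.discr K : ℚ)).torsionOrder = 2 := by
      rw [quadraticTwist_quadraticTwist]; exact torsionOrder_M0_quadraticTwist (mul_ne_zero hdQ hDQ)
    have h := eq_zero_of_odd_nsmul_eq_zero_quadraticTwist_one_baseChange hK _ h1 h2 (e.symm P) hm
      (by rw [← map_nsmul, hP, map_zero])
    simpa using congrArg e h

/-- **`t_K = #W(K)_tors = 2` FOR EVERY MODEL `W` OF `X₀(49)^{(d)}` (`d ≠ 0`) AND EVERY IMAGINARY QUADRATIC `K` WITH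
`−7 ∉ K²`** (i.e. `K ≠ ℚ(√−7)`; every Heegner field of the cell qualifies, `not_isSquare_neg_seven_of_jacobiSym_eq_one`):
the change `(2⁻¹, 2d, 0, 0) ∘ C` takes `W` to the two-torsion normal form `⟨0, 21d, 0, 112d², 0⟩` over `ℚ`, hence over
`K` (`VariableChange.baseChange_smul_eq`), and `#tors` is invariant (`torsionOrder_variableChange_holds`).
[cite: SilvermanTate2015, §3.5] [cite: Olson1974, Thm. 1 (j = −3375)] [cite: SilvermanAEC2009, VII.3 and Exercise 10.16] -/
theorem torsionOrder_baseChange_eq_two_of_smul_eq_cm7_quadraticTwist {d : ℤ} (hd : d ≠ 0)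
    (W : WeierstrassCurve ℚ) (C : VariableChange ℚ) (hC : C • W = cm7.quadraticTwist (d : ℚ))
    (hK : IsImaginaryQuadratic K) (h7 : ¬ IsSquare (-7 : K)) :
    (W.baseChange K).torsionOrder = 2 := by
  set C₂ : VariableChange ℚ := ⟨(Units.mk0 (2 : ℚ) two_ne_zero)⁻¹, 2 * d, 0, 0⟩ with hC₂def
  have hC₂ : (C₂ * C) • W = (⟨0, 21 * (d : ℚ), 0, 112 * (d : ℚ) ^ 2, 0⟩ : WeierstrassCurve ℚ) := by
    rw [mul_smul, hC]
    ext <;> simp [C₂, quadraticTwist, WeierstrassCurve.b₂, WeierstrassCurve.b₄, WeierstrassCurve.b₆,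
      variableChange_a₁, variableChange_a₂, variableChange_a₃, variableChange_a₄, variableChange_a₆] <;> ring
  have hCK : ((C₂ * C).map (algebraMap ℚ K)) • (W.baseChange K) =
      (⟨0, 21 * (d : K), 0, 112 * (d : K) ^ 2, 0⟩ : WeierstrassCurve K) := by
    rw [← VariableChange.baseChange_smul_eq, hC₂]
    ext <;> simp [baseChange, WeierstrassCurve.map, eq_ratCast]
  have hinv := torsionOrder_variableChange_holds (W.baseChange K) ((C₂ * C).map (algebraMap ℚ K))
  unfold torsionOrder_variableChange at hinv
  rw [hCK] at hinv
  rw [← hinv]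
  exact torsionOrder_twoTorsionNF_cell_eq_two hd hK h7

/-- **`t_K = 2` for every curve of the `j = −3375` cell (twist currency `C • W = X₀(49)^{(d)}`, `d` squarefree
`≢ 1 (mod 4)`) and every imaginary quadratic `K` with the Heegner hypothesis at `2, 7, ℓ ∣ d`** (`7` splits in `K`, so
`−7 ∉ K²`). [cite: SilvermanTate2015, §3.5] [cite: Olson1974, Thm. 1 (j = −3375)] [cite: Cox2013, §7.A] -/
theorem torsionOrder_baseChange_eq_two_of_cellTwist {d : ℤ} (hsq : Squarefree d) (hd4 : d % 4 ≠ 1)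
    (W : WeierstrassCurve ℚ) (C : VariableChange ℚ) (hC : C • W = cm7.quadraticTwist (d : ℚ))
    (hK : IsImaginaryQuadratic K) (hHd : SatisfiesHeegnerHypothesis (14 * d.natAbs) K) :
    (W.baseChange K).torsionOrder = 2 := by
  obtain ⟨-, -, hD7, -⟩ := heegnerDiscr_arith_of_split' hK hsq hd4 hHd
  exact torsionOrder_baseChange_eq_two_of_smul_eq_cm7_quadraticTwist hsq.ne_zero W C hC hK
    (not_isSquare_neg_seven_of_jacobiSym_eq_one hK hD7)

end Cell

/-! ## §4 The exact value of `ord₂ 𝔮` on the cell with `t_K` folded -/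

section ExactOrder

variable {d : ℤ}

/-- **THE EXACT VALUE OF `ord₂ 𝔮` ON THE `j = −3375` CELL, `t_K` FOLDED.** In the data of
`padicValRat_cmHeegnerIndexQuotient_cell_eq` (`C • W = X₀(49)^{(d)}`, `d` squarefree `≢ 1 (mod 4)`, `W`, `Wd` globally
minimal, an admissible Heegner datum with the Heegner hypothesis at `N` and at `2, 7, ℓ ∣ d`; GRANTED Gross–Zagier,
Kolyvagin, GZK, modularity, Burungale–Flach):
`ord₂ 𝔮 = 2·ord₂ I − 2·ord₂ k − 2·ord₂ c + 3 − ord₂ #Ш(Wd) − (3 + ι(d·D) + 2σ′(d·D)) − (3 + ι(d) + 2σ′(d))`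
(`I = [W(K) : ℤP]`, `k` the halvability value, `c` the Manin constant of `Dt`, `D = d_K`; `ι`, `σ′` the inert /
split-prime-to-`14` counts), the factor `t_K = #W(K)_tors` of the previous hand's formula being `2`
(`torsionOrder_baseChange_eq_two_of_cellTwist`). So the two registered half-stubs of line «heegner-halves» v2 read, on this
cell: `ord₂ #Ш(W) ≤ / ≥ 2·ord₂ I − 2·ord₂ k − 2·ord₂ c − 3 − ord₂ #Ш(Wd) − (ι(d) + ι(d·D)) − 2(σ′(d) + σ′(d·D))`.
[cite: GrossZagier1986, Thm. I.6.3 and V.§2] [cite: BurungaleFlach2024, Thm. 1.1 and Cor. 2] [cite: Olson1974, Thm. 1]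
[cite: Silverman1994, IV.9 Table 4.1] [cite: Cox2013, §7.A] -/
theorem padicValRat_cmHeegnerIndexQuotient_cell_eq_of_torsionK
    (hsq : Squarefree d) (hd4 : d % 4 ≠ 1)
    (W : WeierstrassCurve ℚ) [W.IsElliptic] [W.IsGloballyMinimal] (C : VariableChange ℚ)
    (hC : C • W = cm7.quadraticTwist (d : ℚ))
    (N : ℕ) [NeZero N] (K : Type) [Field K] [NumberField K]
    (Dt : ModularParametrizationData W N) (H : HeegnerDatum N (NumberField.discr K)) (ι : K →+* ℂ)
    (P : (W.baseChange K).toAffine.Point)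
    (hGZ : gross_zagier N W K) (hKo : kolyvagin N W K)
    (hGZK : rank_eq_analyticRank_of_analyticRank_le_one) (hmod : hasEntireLFunction_rat)
    (hBF : bsdTriple_of_hasCM_of_L_one_ne_zero)
    (hK : IsImaginaryQuadratic K) (hHN : SatisfiesHeegnerHypothesis N K)
    (hHd : SatisfiesHeegnerHypothesis (14 * d.natAbs) K)
    (hP : WeierstrassCurve.Affine.Point.map ι.toRatAlgHom P = heegnerPointComplex Dt H)
    (hr : W.analyticRank = 1)
    (hLt : (W.quadraticTwist (NumberField.discr K : ℚ)).entireLFunction 1 ≠ 0)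
    (Wd : WeierstrassCurve ℚ) [Wd.IsElliptic] [Wd.IsGloballyMinimal] (Cd : VariableChange ℚ)
    (hWd : Cd • W.quadraticTwist (NumberField.discr K : ℚ) = Wd) (k : ℕ) (hk12 : k = 1 ∨ k = 2) :
    padicValRat 2 (cmHeegnerIndexQuotient W K P Dt.c k Wd Cd.u) =
      2 * (padicValNat 2 (AddSubgroup.zmultiples P).index : ℤ) - 2 * (padicValNat 2 k : ℤ)
        - 2 * padicValRat 2 (Dt.c : ℚ) + 3 - (padicValNat 2 Wd.shaOrder : ℤ)
        - ((3 + (((d * NumberField.discr K).natAbs.primeFactors.erase 2).filter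
              (fun l : ℕ => jacobiSym l 7 = -1)).card +
            2 * ((((d * NumberField.discr K).natAbs.primeFactors.erase 2).erase 7).filter
              (fun l : ℕ => ¬ jacobiSym l 7 = -1)).card : ℕ) : ℤ)
        - ((3 + ((d.natAbs.primeFactors.erase 2).filter (fun l : ℕ => jacobiSym l 7 = -1)).card +
            2 * (((d.natAbs.primeFactors.erase 2).erase 7).filter (fun l : ℕ => ¬ jacobiSym l 7 = -1)).card : ℕ) : ℤ) := by
  rw [padicValRat_cmHeegnerIndexQuotient_cell_eq hsq hd4 W C hC N K Dt H ι P hGZ hKo hGZK hmod hBF hK hHN hHd hP hr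
    hLt Wd Cd hWd k hk12, torsionOrder_baseChange_eq_two_of_cellTwist hsq hd4 W C hC hK hHd,
    show padicValNat 2 2 = 1 from padicValNat_self]
  push_cast
  ring

end ExactOrder

/-! ## §5 Every `K`-torsion point of a cell curve is `ℚ`-rational -/

section RationalTorsion

variable {K : Type} [Field K] [NumberField K]

/-- **`W(K)_tors = W(ℚ)_tors` for every model `W` of `X₀(49)^{(d)}` (`d ≠ 0`) and every imaginary quadratic `K` with
`−7 ∉ K²`:** every torsion point of `W(K)` is the image of a point of `W(ℚ)` under the inclusion `incl`. Counting proof: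
`incl` is injective and maps `W(ℚ)_tors` into `W(K)_tors`, and both have order `2` (`torsionOrder_eq_two_of_j_eq`,
`j = −3375`; `torsionOrder_baseChange_eq_two_of_smul_eq_cm7_quadraticTwist`), so the restriction is a bijection. (For the
line: in the halvability clause of the half-stubs, `incl y − 2 • Q ∈ W(K)_tors` may be read with `W(K)_tors = {O, T} ⊂ W(ℚ)`.)
[cite: SilvermanAEC2009, VII.3 and VIII.7] [cite: Olson1974, Thm. 1 (j = −3375)] -/
theorem exists_incl_eq_of_isOfFinAddOrder_of_smul_eq_cm7_quadraticTwist {d : ℤ} (hd : d ≠ 0)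
    (W : WeierstrassCurve ℚ) [W.IsElliptic] (C : VariableChange ℚ) (hC : C • W = cm7.quadraticTwist (d : ℚ))
    (hK : IsImaginaryQuadratic K) (h7 : ¬ IsSquare (-7 : K))
    {t : (W.baseChange K).toAffine.Point} (ht : IsOfFinAddOrder t) :
    ∃ y : W.toAffine.Point, incl K W y = t := by
  -- the `ℚ`-point groups of the tree's `incl` / `torsionOrder` live in the classical decidability world
  letI : DecidableEq ℚ := fun a b => Classical.propDecidable (a = b)
  have hW2 : W.torsionOrder = 2 :=
    torsionOrder_eq_two_of_j_eq W (Or.inl (minimalModel_quadraticTwist_cm7 hd W C hC).1)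
  have hK2 : (W.baseChange K).torsionOrder = 2 :=
    torsionOrder_baseChange_eq_two_of_smul_eq_cm7_quadraticTwist hd W C hC hK h7
  -- the restriction of `incl` to the torsion subgroups is injective between sets of the same size `2`
  let f : AddCommGroup.torsion W.toAffine.Point → AddCommGroup.torsion (W.baseChange K).toAffine.Point :=
    fun a => ⟨incl K W a, (AddCommGroup.mem_torsion _).mpr
      ((incl K W).isOfFinAddOrder ((AddCommGroup.mem_torsion _).mp a.2))⟩
  have hfinj : Function.Injective f := fun a b hab =>
    Subtype.ext (incl_injective (K := K) W (congrArg Subtype.val hab))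
  have hKcard : Nat.card (AddCommGroup.torsion (W.baseChange K).toAffine.Point) = 2 := hK2
  have hQcard : Nat.card (AddCommGroup.torsion W.toAffine.Point) = 2 := hW2
  haveI : Finite (AddCommGroup.torsion (W.baseChange K).toAffine.Point) :=
    Nat.finite_of_card_ne_zero (by rw [hKcard]; norm_num)
  obtain ⟨a, ha⟩ := (hfinj.bijective_of_nat_card_le (by rw [hKcard, hQcard])).2
    ⟨t, (AddCommGroup.mem_torsion _).mpr ht⟩
  exact ⟨a, congrArg Subtype.val ha⟩

/-- **`W(K)_tors = W(ℚ)_tors` on the `j = −3375` cell for every Heegner field** (twist currency `C • W = X₀(49)^{(d)}`,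
`d` squarefree `≢ 1 (mod 4)`; `K` imaginary quadratic with the Heegner hypothesis at `2, 7, ℓ ∣ d`).
[cite: SilvermanAEC2009, VII.3 and VIII.7] [cite: Olson1974, Thm. 1 (j = −3375)] [cite: Cox2013, §7.A] -/
theorem exists_incl_eq_of_isOfFinAddOrder_of_cellTwist {d : ℤ} (hsq : Squarefree d) (hd4 : d % 4 ≠ 1)
    (W : WeierstrassCurve ℚ) [W.IsElliptic] (C : VariableChange ℚ) (hC : C • W = cm7.quadraticTwist (d : ℚ))
    (hK : IsImaginaryQuadratic K) (hHd : SatisfiesHeegnerHypothesis (14 * d.natAbs) K)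
    {t : (W.baseChange K).toAffine.Point} (ht : IsOfFinAddOrder t) :
    ∃ y : W.toAffine.Point, incl K W y = t := by
  obtain ⟨-, -, hD7, -⟩ := heegnerDiscr_arith_of_split' hK hsq hd4 hHd
  exact exists_incl_eq_of_isOfFinAddOrder_of_smul_eq_cm7_quadraticTwist hsq.ne_zero W C hC hK
    (not_isSquare_neg_seven_of_jacobiSym_eq_one hK hD7) ht

end RationalTorsion

end Summit.BirchSwinnertonDyer.BirchSwinnertonDyer.Theorems.GoldfeldGoodTwists

end
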